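import Literature.NumberTheory.Automorphic.Liu2021.LemD1SplitPlaceOfFacts
import HarnessLib

/-!
# `hD1''` line `a4-liuD1pp`, stub (4) `stub_splitPlace_model_consequences : SplitPlaceModelConsequences` — FROM THE TWO INTERFACE FACTS
# IV-3(a) `splitPlace_chiCoinv_iso_parabolicIndGL` and IV-3(b) `parabolicIndGL_detChar_unitary_isIrreducible`, BY NAME
# (cell `hodgecm-mathlib`, fan A ↔ fan B junction for the binder `HypD1pp` = stmt-HodgeConjecture-24838)

Summits side, binder subdirectory `CorCM/HypD1pp/`.  The crux skeleton `A-plan/lines/a4-liuD1pp.lean` (sha16 2ff805ec0320d57a,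
REF1 PASS 2026-08-28T01:22:16Z) registers as stub (4) fan B's stub `stub_splitPlace_model_consequences` of line `b4-lemD1-item1-at-v`
CLOSED OVER ITS VARIABLE BLOCK, the Prop `PerPlace.SplitPlaceModelConsequences`: at a place `v` SPLIT in `E`, for a family `𝓢` whose
local Weil representation at `v` is `L²(μ'ⁿ)`-isometric, the `χ_{1,v}`-coinvariant quotient of `ω_v = 𝓢.omegaLoc v` along the local centre
is irreducible-or-zero, admissible and NON-ZERO [Liu2021, App. D, proof of Lem. D.1, l. 5253: «identify U(V) with GL_n(F) … ω(μ, ε, χ) is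
isomorphic to the unitary induction from P_{n−1,1} of (ν∘det) ⊠ χν^{1−n}»; GelbartRogawski1990 §2.6; Zelevinsky1980 Thm 4.2].

Fan B closed that stub MODULO the two interface facts of record — IV-3(a) `Liu2021.splitPlace_chiCoinv_iso_parabolicIndGL` (the split-place
model, `Liu2021/SplitPlaceOscillatorModel.lean`, p590532) and IV-3(b) `Zelevinsky1980.parabolicIndGL_detChar_unitary_isIrreducible`
(`Zelevinsky1980/ParabolicIndGLDetCharIrreducible.lean`, p589979) — by the tree theorem
`Literature.NumberTheory.Automorphic.Liu2021.Def411WeilCarriers.splitPlace_model_consequences_of_facts` (`Liu2021/LemD1SplitPlaceOfFacts.lean`,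
p592614).  This file restates that closure in the A-side currency: `splitPlaceModelConsequences_of_facts : IV-3(a) → IV-3(b) →
<PerPlace.SplitPlaceModelConsequences, verbatim>` — CONDITIONAL on the two named facts only (D-0014; their `_holds` theorems are the cell's
KEYs `b4-split-place-model` ∕ `b4-unitary-induction-irreducible`), so that at crux-write time the A-side stub closes by
`:= splitPlaceModelConsequences_of_facts splitPlace_chiCoinv_iso_parabolicIndGL_holds parabolicIndGL_detChar_unitary_isIrreducible_holds`.

HC_CM is proved only modulo the 7 printed citations (`hDel`, `h21`, `hLiu418`, `h411`, `h413`, `hD3`, `hD1''`) until rung 0 closes;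
this file discharges no binder and no interface fact.

## References
* [Liu2021] Y. Liu, Camb. J. Math. 9 (2021) = arXiv:2102.11518, App. D, proof of Lemma D.1, first paragraph (l. 5253, p. 126).
* [GelbartRogawski1990] S. Gelbart, J. Rogawski, §2.6.
* [Zelevinsky1980] A. Zelevinsky, Ann. Sci. ÉNS 13 (1980), Thm 4.2.
* [BernsteinZelevinsky1977] I. N. Bernstein, A. V. Zelevinsky, Ann. Sci. ÉNS 10 (1977), Prop. 2.3 (admissibility of induction).
-/

set_option autoImplicit false

noncomputable section

namespace Summit.HodgeConjecture.CorCM.HypD1pp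

open scoped Matrix Kronecker TensorProduct Classical RestrictedProduct
open NumberField NumberField.mixedEmbedding IsDedekindDomain Filter Set
open Literature.NumberTheory.Automorphic Literature.NumberTheory.Automorphic.UnitaryGroup
open Literature.NumberTheory.Weil1964 Literature.RepresentationTheory
open Literature.RepresentationTheory.HeisenbergGroup
open Literature.GroupTheory.RestrictedProductCharacter
open Literature.NumberTheory Literature.NumberTheory.GelbartRogawski1991 Literature.NumberTheory.GelbartRogawski1991.UnitaryDualPair
open Literature.NumberTheory.GelbartRogawski1991.UnitaryDualPair.WeilCoinv
open Literature.NumberTheory.Automorphic.Liu2021 Literature.NumberTheory.Automorphic.Liu2021.Def411WeilCarriers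
open Literature.RepresentationTheory.CentralCharacterQuotient (augmentation quotRep)
open Literature.RepresentationTheory.MoeglinVignerasWaldspurger1987
open MeasureTheory

/-- **Line `a4-liuD1pp`, stub (4) `SplitPlaceModelConsequences` FROM the interface facts IV-3(a) and IV-3(b)** — for every quadratic `E/F`,
frame `J_V = T_V ⊗ 1`, line `a`, family `𝓢`, `3 ≤ n`, unitary continuous `χ₁`, finite place `v` and Haar measure `μ'` on `F_v`: if `v` is
SPLIT in `E` and `ω_v = 𝓢.omegaLoc v` is `L²(μ'ⁿ)`-isometric, then the `χ_{1,v}`-coinvariant quotient of `ω_v` along the local centre is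
irreducible-or-zero, admissible and non-zero — GIVEN the split-place model `splitPlace_chiCoinv_iso_parabolicIndGL` [Liu2021, proof of Lem. D.1,
l. 5253; MoeglinVignerasWaldspurger1987 Chap. 3 §III.7 a)] and the irreducibility of unitary induction from the `(n−1,1)` parabolic
`parabolicIndGL_detChar_unitary_isIrreducible` [Zelevinsky1980, Thm 4.2] as hypotheses by name.  Conclusion = the body of
`Summit.HodgeConjecture.CorCM.Lines.A4LiuD1pp.PerPlace.SplitPlaceModelConsequences` (a4-liuD1pp.lean 2ff805ec0320d57a), character for
character; proof = fan B's `Def411WeilCarriers.splitPlace_model_consequences_of_facts` (p592614).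
[cite: Liu2021, App. D, proof of Lemma D.1 (first paragraph), p. 126] [cite: GelbartRogawski1990, §2.6] [cite: Zelevinsky1980, Thm. 4.2] -/
theorem splitPlaceModelConsequences_of_facts (hIV3a : splitPlace_chiCoinv_iso_parabolicIndGL)
    (hIV3b : Zelevinsky1980.parabolicIndGL_detChar_unitary_isIrreducible.{0}) :
    ∀ (F E : Type) [Field F] [NumberField F] [Field E] [NumberField E] [Algebra F E]
    (c : E ≃ₐ[F] E) (N : ℕ) {n : ℕ} (e : Fin N × Fin 1 ≃ Fin n)
    (JV : Matrix (Fin N) (Fin N) E) {TV : Matrix (Fin N) (Fin N) F}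
    [Algebra.IsQuadraticExtension F E] {δ : E} (hcδ : c δ = -δ) (hδ : δ ≠ 0) {d : F}
    (hd : δ * δ = algebraMap F E d) (hV : TV.IsSymm) (hVd : IsUnit TV.det) (hJV : JV = TV.map (algebraMap F E))
    (a : Fˣ)
    (𝓢 : LocalSplitting.FinLocalSplittings F E c n hcδ hδ hd (gram F e TV (TW F a)) (isSymm_gram F e hV (isSymm_TW F a))
      (reindex_kronecker_eq_gram_map F E e hJV (JW_eq F E a)))
    (hn : 3 ≤ n)
    (χ₁ : UnitaryGroup.finAdelicOne F E c →* ℂˣ) (hχ₁n : ∀ u, ‖((χ₁ u : ℂˣ) : ℂ)‖ = 1) (hχ₁c : Continuous χ₁)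
    (v : HeightOneSpectrum (𝓞 F)) [MeasurableSpace (v.adicCompletion F)] [BorelSpace (v.adicCompletion F)]
    (μ' : Measure (v.adicCompletion F)) [μ'.IsAddHaarMeasure],
    ¬ IsField (LocalRing E v) → (𝓢.omegaLoc v).IsL2Isometric (Measure.pi fun _ : Fin n => μ') →
      IsIrreducibleOrZero (TwistedCoinv.rep
        (ρW := show Representation ℂ (localPi E c 1 (JW F E a) v) (SchwartzBruhat (Fin n → v.adicCompletion F)) from
          (𝓢.omegaLoc v).comp (localCenter E c n (Matrix.reindex e e (JV ⊗ₖ JW F E a)) (JW F E a) (JW_apply_ne_zero F E a) v))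
        (localCharOfCenter F E c (JW F E a) (JW_apply_ne_zero F E a) χ₁ v) (𝓢.omegaLoc v)
        (fun g z => (show Commute g (localCenter E c n (Matrix.reindex e e (JV ⊗ₖ JW F E a)) (JW F E a) (JW_apply_ne_zero F E a) v z) from
        localCenter_comm E c n (Matrix.reindex e e (JV ⊗ₖ JW F E a)) (JW F E a) (JW_apply_ne_zero F E a) v z g).map (𝓢.omegaLoc v))) ∧
      (TwistedCoinv.rep
        (ρW := show Representation ℂ (localPi E c 1 (JW F E a) v) (SchwartzBruhat (Fin n → v.adicCompletion F)) from
          (𝓢.omegaLoc v).comp (localCenter E c n (Matrix.reindex e e (JV ⊗ₖ JW F E a)) (JW F E a) (JW_apply_ne_zero F E a) v))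
        (localCharOfCenter F E c (JW F E a) (JW_apply_ne_zero F E a) χ₁ v) (𝓢.omegaLoc v)
        (fun g z => (show Commute g (localCenter E c n (Matrix.reindex e e (JV ⊗ₖ JW F E a)) (JW F E a) (JW_apply_ne_zero F E a) v z) from
        localCenter_comm E c n (Matrix.reindex e e (JV ⊗ₖ JW F E a)) (JW F E a) (JW_apply_ne_zero F E a) v z g).map (𝓢.omegaLoc v))).IsAdmissible ∧
      Nontrivial (TwistedCoinv.Coinv
        (show Representation ℂ (localPi E c 1 (JW F E a) v) (SchwartzBruhat (Fin n → v.adicCompletion F)) from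
          (𝓢.omegaLoc v).comp (localCenter E c n (Matrix.reindex e e (JV ⊗ₖ JW F E a)) (JW F E a) (JW_apply_ne_zero F E a) v))
        (localCharOfCenter F E c (JW F E a) (JW_apply_ne_zero F E a) χ₁ v)) :=
  fun F E _ _ _ _ _ c N _ e JV _ _ _ hcδ hδ _ hd hV hVd hJV a 𝓢 hn χ₁ hχ₁n hχ₁c v _ _ μ' _ =>
    splitPlace_model_consequences_of_facts F E c N e JV hcδ hδ hd hV hVd hJV a 𝓢 hn χ₁ hχ₁n hχ₁c v hIV3a hIV3b μ'

end Summit.HodgeConjecture.CorCM.HypD1pp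

end
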